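import Mathlib
import HarnessLib

/-!
# E-imc-90a / E-imc-90b: the pure-algebra core of the 2-adic isolation certificate (`OddCongruenceNumberOfIsolationCertificate`)

Summit `BirchSwinnertonDyer`, route `ManinLocalTwoThree` (cell bsd-f2-manin), deciding crux C2 `ManinOddAtFour`
(stmt-BirchSwinnertonDyer-22967).  LANDED VERBATIM from the planner-of-record's kernel-checked sketches
HOME/imc/E90a-imc-g15.lean (sha16 95aa85874ea4c4f0) and HOME/imc/E90b-imc-g15.lean (b7d9bdf407cfa931) — imc g15,
MEMO-imc §21 (2-Eisenstein isolation at `4p`), TURNKEY-imc-E90a/E90b (INBOX 2026-08-28T09:56Z / 10:04Z); only the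
namespace is changed (`…Cruxes.ManinOddAtFour.TwoEisensteinRankOne` ↦ `…Theorems.ManinLocalTwoThree`).  Mathlib only.

* `no_two_torsion_of_modTwoIsolation`, `odd_card_quotient_of_modTwoIsolation` (E-imc-90a): for an abelian group `S`,
  `f ∈ S` not divisible by `2`, a `2`-saturated subgroup `P`, an endomorphism `T` with `T f = a • f`, `a` even, and
  "`T` injective mod `2` on `P`", the quotient `S ⧸ (ℤf + P)` has no element of order `2`, hence odd order when finite;
* `even_of_mulVec_even`, `exists_eq_two_smul_of_det_odd` (E-imc-90b): an integer matrix / a `ℤ`-linear endomorphism of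
  a finite free `ℤ`-module with ODD determinant is injective mod `2` (adjugate).

WHAT THIS IS FOR (imc): with `S = S₂(Γ₀(N); ℤ)`, `P = (ℤf)^⊥`, `T = T_ℓ`, the tree's `congruenceNumber f = #(S ⧸ (ℤf + P))`
and a 2-adic isolation certificate `v₂ det((1+ℓ) − T_ℓ | S₂) = v₂(1 + ℓ − a_ℓ)` (⇒ `det((1+ℓ) − T_ℓ | P)` odd), E-imc-90
«the congruence number `r_f` is odd» follows; then `modularDegree ∣ congruenceNumber` (Ribet) and the ČNS odd-degree
tooth (`not_two_dvd_maninConstant_of_cns_of_odd_deg`) give C2 on each certified family level.  The instantiation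
(determinant base change `ℂ/ℤ`, block form on `ℚf ⊕ P_ℚ`) is NOT done here.  Nothing about BSD, Manin's conjecture
or any Manin constant is asserted.
-/

set_option linter.dupNamespace false

namespace Summit.BirchSwinnertonDyer.BirchSwinnertonDyer.Theorems.ManinLocalTwoThree


/-- **E-imc-90a.** Let `S` be an abelian group, `f ∈ S` not divisible by `2`, `P ≤ S` a
`2`-saturated subgroup, `T` an endomorphism with `T f = a • f`, `a` even, such that
`T` is "injective mod 2 on `P`" (`p ∈ P`, `T p ∈ 2S` ⇒ `p ∈ 2S`).  Then the quotient
`S / (ℤf + P)` has no element of order `2`. [folklore] -/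
theorem no_two_torsion_of_modTwoIsolation {S : Type*} [AddCommGroup S]
    (f : S) (P : Submodule ℤ S) (T : S →ₗ[ℤ] S) (a : ℤ)
    (hf : ¬ ∃ y : S, f = (2 : ℤ) • y)
    (hsat : ∀ x : S, (2 : ℤ) • x ∈ P → x ∈ P)
    (hT : T f = a • f) (ha : (2 : ℤ) ∣ a)
    (hinj : ∀ p ∈ P, (∃ y : S, T p = (2 : ℤ) • y) → ∃ y : S, p = (2 : ℤ) • y) :
    ∀ s : S, (2 : ℤ) • s ∈ (ℤ ∙ f) ⊔ P → s ∈ (ℤ ∙ f) ⊔ P := by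
  intro s hs
  rw [Submodule.mem_sup] at hs
  obtain ⟨u, hu, q, hq, huq⟩ := hs
  rw [Submodule.mem_span_singleton] at hu
  obtain ⟨α, rfl⟩ := hu
  obtain ⟨a', rfl⟩ := ha
  rcases Int.even_or_odd' α with ⟨β, hβ | hβ⟩
  · -- α = 2β : then q = 2 • (s - β • f) ∈ P, saturation gives s - β • f ∈ P
    have hq2 : q = (2 : ℤ) • (s - β • f) := by
      have : q = (2 : ℤ) • s - α • f := by rw [← huq]; abel
      rw [this, hβ, smul_sub, mul_smul]
    have hmem : s - β • f ∈ P := hsat _ (hq2 ▸ hq)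
    rw [Submodule.mem_sup]
    exact ⟨β • f, Submodule.mem_span_singleton.mpr ⟨β, rfl⟩, s - β • f, hmem, by abel⟩
  · -- α = 2β+1 : then q ≡ f (mod 2S) and T q ∈ 2S, so q ∈ 2S and f ∈ 2S — contradiction
    exfalso
    apply hf
    have hq' : q = (2 : ℤ) • s - α • f := by rw [← huq]; abel
    have hTq : ∃ y : S, T q = (2 : ℤ) • y := by
      refine ⟨T s - (α * a') • f, ?_⟩
      rw [hq', map_sub, map_smul, map_smul, hT, smul_sub, smul_smul, smul_smul]
      congr 2
      ring
    obtain ⟨y, hy⟩ := hinj q hq hTq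
    refine ⟨s - β • f - y, ?_⟩
    have key : α • f = (2 : ℤ) • s - (2 : ℤ) • y := by rw [← hy, hq']; abel
    rw [hβ, add_smul, one_smul, mul_smul] at key
    calc f = ((2 : ℤ) • β • f + f) - (2 : ℤ) • β • f := by abel
      _ = ((2 : ℤ) • s - (2 : ℤ) • y) - (2 : ℤ) • β • f := by rw [key]
      _ = (2 : ℤ) • (s - β • f - y) := by rw [smul_sub, smul_sub]; abel

/-- Corollary: with the quotient finite, its order is odd. [folklore] -/
theorem odd_card_quotient_of_modTwoIsolation {S : Type*} [AddCommGroup S]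
    (f : S) (P : Submodule ℤ S) (T : S →ₗ[ℤ] S) (a : ℤ)
    (hf : ¬ ∃ y : S, f = (2 : ℤ) • y)
    (hsat : ∀ x : S, (2 : ℤ) • x ∈ P → x ∈ P)
    (hT : T f = a • f) (ha : (2 : ℤ) ∣ a)
    (hinj : ∀ p ∈ P, (∃ y : S, T p = (2 : ℤ) • y) → ∃ y : S, p = (2 : ℤ) • y)
    [Finite (S ⧸ ((ℤ ∙ f) ⊔ P))] :
    Odd (Nat.card (S ⧸ ((ℤ ∙ f) ⊔ P))) := by
  classical
  by_contra hodd
  rw [Nat.not_odd_iff_even, even_iff_two_dvd] at hodd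
  haveI : Fact (Nat.Prime 2) := ⟨Nat.prime_two⟩
  haveI : Fintype (S ⧸ ((ℤ ∙ f) ⊔ P)) := Fintype.ofFinite _
  rw [Nat.card_eq_fintype_card] at hodd
  obtain ⟨x, hx⟩ := exists_prime_addOrderOf_dvd_card 2 hodd
  obtain ⟨s, rfl⟩ := Submodule.Quotient.mk_surjective _ x
  have h2 : Submodule.Quotient.mk (p := (ℤ ∙ f) ⊔ P) (s + s) = 0 := by
    have := addOrderOf_nsmul_eq_zero (Submodule.Quotient.mk (p := (ℤ ∙ f) ⊔ P) s)
    rw [hx, two_nsmul] at this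
    rw [Submodule.Quotient.mk_add]
    exact this
  have hs : (2 : ℤ) • s ∈ (ℤ ∙ f) ⊔ P := by
    rw [two_smul]
    exact (Submodule.Quotient.mk_eq_zero _).mp h2
  have hmem := no_two_torsion_of_modTwoIsolation f P T a hf hsat hT ha hinj s hs
  have : Submodule.Quotient.mk (p := (ℤ ∙ f) ⊔ P) s = 0 :=
    (Submodule.Quotient.mk_eq_zero _).mpr hmem
  rw [this, addOrderOf_zero] at hx
  norm_num at hx



open Matrix in
/-- Matrix form: if `det A` is odd and `A *ᵥ v` has even entries then `v` has even entries
(multiply by the adjugate: `adj A *ᵥ (A *ᵥ v) = det A • v`). [folklore] -/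
theorem even_of_mulVec_even {n : Type*} [Fintype n] [DecidableEq n] (A : Matrix n n ℤ)
    (hA : Odd A.det) (v : n → ℤ) (h : ∀ i, Even ((A *ᵥ v) i)) : ∀ i, Even (v i) := by
  intro i
  have key : (A.adjugate *ᵥ (A *ᵥ v)) i = A.det * v i := by
    rw [mulVec_mulVec, adjugate_mul, smul_mulVec, one_mulVec]
    simp
  have heven : Even ((A.adjugate *ᵥ (A *ᵥ v)) i) := by
    simp only [mulVec, dotProduct]
    exact Finset.even_sum _ (fun j _ ↦ (h j).mul_left _)
  rw [key] at heven
  rcases Int.even_mul.mp heven with hdet | hv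
  · exact absurd hdet (Int.not_even_iff_odd.mpr hA)
  · exact hv

open Matrix in
/-- **E-imc-90b (algebraic half).** `P` a finite free `ℤ`-module, `U : P →ₗ[ℤ] P` with odd determinant:
if `U p ∈ 2P` then `p ∈ 2P`. [folklore] -/
theorem exists_eq_two_smul_of_det_odd {P : Type*} [AddCommGroup P]
    [Module.Free ℤ P] [Module.Finite ℤ P] (U : P →ₗ[ℤ] P) (hU : Odd (LinearMap.det U))
    (p q : P) (h : U p = (2 : ℤ) • q) : ∃ r : P, p = (2 : ℤ) • r := by
  classical
  let b := Module.Free.chooseBasis ℤ P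
  haveI : Fintype (Module.Free.ChooseBasisIndex ℤ P) := Module.Free.ChooseBasisIndex.fintype ℤ P
  set A : Matrix _ _ ℤ := LinearMap.toMatrix b b U with hAdef
  have hA : Odd A.det := by rwa [hAdef, LinearMap.det_toMatrix]
  have hmul : A *ᵥ (b.repr p : _ → ℤ) = (b.repr (U p) : _ → ℤ) := by
    rw [hAdef, LinearMap.toMatrix_mulVec_repr]
  have hev : ∀ i, Even ((A *ᵥ (b.repr p : _ → ℤ)) i) := by
    intro i
    rw [hmul, h, LinearEquiv.map_smul]
    exact ⟨b.repr q i, by simp [two_mul]⟩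
  have hp := even_of_mulVec_even A hA _ hev
  refine ⟨∑ i, (b.repr p i / 2) • b i, ?_⟩
  rw [Finset.smul_sum]
  conv_lhs => rw [← b.sum_repr p]
  refine Finset.sum_congr rfl (fun i _ ↦ ?_)
  rw [smul_smul, Int.mul_ediv_cancel' ((even_iff_two_dvd).mp (hp i))]

end Summit.BirchSwinnertonDyer.BirchSwinnertonDyer.Theorems.ManinLocalTwoThree
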